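import Mathlib
import HarnessLib
import HarnessLib.Audit
import Summits.HodgeConjecture.Statement
import Literature.AlgebraicGeometry.Motives.PeriodComparison
import Literature.AlgebraicGeometry.Motives.MotivatedCycles
import Literature.AlgebraicGeometry.Motives.Sweep1
import Literature.AlgebraicGeometry.Motives.HodgeTensor
import Literature.AlgebraicGeometry.Motives.NoriInterface
import Literature.AlgebraicGeometry.Motives.HodgeTensorDualProofs
import Literature.AlgebraicGeometry.Motives.HodgeTensorDualOpposedProofs
import Literature.AlgebraicGeometry.Motives.HodgeTensorProductProofs
import Literature.AlgebraicGeometry.Motives.HodgeTensorProofs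
import Literature.AlgebraicGeometry.Motives.HodgeTensorHomSeparationProofs
import Literature.AlgebraicGeometry.Motives.HodgeTensorHomProofs
import Literature.AlgebraicGeometry.Motives.HodgeTensorPowerOpposedProofs
import Literature.AlgebraicGeometry.Motives.MotivatedPeriodTorsor
import Literature.AlgebraicGeometry.Motives.BettiHodgeClassicalPin
import HarnessLib.Audit.Status.Attr

/-!
Route: PeriodsPolice

DORMANT since 2026-08-27T04:03:41Z (reconciler: no traction for 5 d (last activity item-proof-filed at 2026-08-22T02:29:18Z); parked, not closed — `ledger route dormant route-HodgeConjecture-PeriodsPolice --off` to reactivate) — unstaffed, not closed; items shared with open routes are served there. `ledger route dormant <id> --off` reactivates.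

Thesis X (idea card periods-police-motivic-galois-normality; route-choice 2026-08-16: the former
CONDITIONAL-BRIDGE declaration on the Grothendieck–André period conjecture is realised IN-ROUTE —
its twist-invariant, actually-consumed content is crux 6 GrothendieckPeriodConjecture (filtered
torsor density C′) feeding crux 2 through the provable support TorsorGPCImpliesPolicing; GPC proper
for the classical Nori instance,
Literature.AlgebraicGeometry.Motives.NoriMotivicInterface.GrothendieckPeriodConjecture at M = h(X₀)
(HuberMullerStachPeriods2017 Conj. 13.2.5 (1), ev_M injective, i.e. Z_X = Ω^And_X by Arapura's André
= pure Nori comparison; implied by Bost–Charles Conj. 2.12 Z_X = Ω^mot_X), implies C′ on paper (the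
comparison point is a filtered point) but is a hypothesis of NOTHING in this route and is not
statable as a non-vacuous Lean Prop today: the Nori predicate has no classical-instance constant (∀N
refuted in tree by not_forall_gpcForAll, ∃N vacuous by gpcForAll_pointModel) and
PeriodRealization.IsClassical v1 pins no de Rham/comparison data, so every ∀P form about THE
comparison point dies by the Deligne-torus twist (refuted-misstated stmt-HodgeConjecture-14226) —
the route therefore no longer depends on it). It suffices to show, for the classical Betti–de Rham
period realization over ℚ̄ (schema-pinned in Lean by Hodge–Riemann I/II, hard Lefschetz and product
polarisations, standing in for PeriodRealization.IsClassical), the five statements the deciding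
theorem consumes:
(1) PeriodsPoliceHodgeClasses [crux 2; card Lemma 1]: the ℚ-points of André's motivated Galois group
of any product-closed family S of smooth projective complex varieties — families g = (g_Y ∈
GL(H_B(Y,ℚ)))_{Y∈S} natural for morphisms, multiplicative for cup products and fixing all motivated
classes — map Hodge classes of every ℚ̄-definable member of S to Hodge classes ("periods police the
motivic Galois group": then MT(X) is normalised, G_And⁰ = MT·C with C of compact type on Hodge
classes — PermutingHodgeTensorsNormalisesMT is the provable normality step); at each X₀/ℚ̄ it is
what crux 6 yields through the provable support TorsorGPCImpliesPolicing (on the powers of X₀, up to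
transport along Y ≅ (X₀)_σ);
(2) CompactCommutantTrivial [crux 3; the card's residual C̄ = 1 with André's Thm 0.4 bundled in]:
such stability forces Hodge ⊆ motivated for ℚ̄-definable varieties — no Weil-type compact group
survives in the commutant of MT inside G_And;
(3) LefschetzB [crux 5, consumed form]: motivated ⇒ algebraic on ℚ̄-definable smooth projective
varieties (André's equivalent of B(𝒱_ℚ̄); B for the Betti theory gives it by the tree theorem
WeilCohomology.motivatedClasses_le_algebraicClasses);
(4) QbarDescent [crux 4]: the Hodge conjecture for all ℚ̄-definable smooth projective complex
varieties implies the Hodge conjecture (weak-absoluteness strength, Voisin2007HodgeLoci Prop. 1.2);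
(5) ClassicalBridge [crux, rank 9; construction/inhabitation risk]: a schema-pinned period
realization over ℚ̄ exists whose B-relative Hodge conjecture is the real-carrier one.
Upper layer (not a hypothesis of the deciding theorem): crux 6 GrothendieckPeriodConjecture = C′:
for X₀/ℚ̄ smooth projective, the FILTERED complex points of the torsor of motivated periods
Ω^And_{X₀} (those carrying Fᵖ H_dR ⊗ ℂ onto the Hodge filtration on every power, the shape of
iso_fil) are ℚ̄-Zariski dense — Z_X·Stab(F) = Ω^And instead of Z_X = Ω^And; granted Ω^And
irreducible this says the Hodge flag (period point) of X₀ is a ℚ̄-generic point of the motivated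
flag variety Ω^And/Stab(F): genus 1 = Schneider1937 (non-CM) / trivial (CM), open from abelian
surfaces on.
Lean: closes : PeriodsPoliceHodgeClasses → CompactCommutantTrivial → QbarDescent → LefschetzB →
ClassicalBridge → HodgeConjecture (PROVED deciding theorem, 8 tactic lines, rev 6; Assembly :
PeriodsPoliceHodgeClasses → CompactCommutantTrivial → LefschetzB → ClassicalBridge → QbarDescent →
HodgeConjecture is the same chain as a Prop), over
Literature.AlgebraicGeometry.Motives.PeriodRealization (AlgebraicClosure ℚ), BettiHodgeData.hodge /
.HodgeConjectureFor, WeilCohomology.motivatedClasses / .HasHardLefschetz,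
PreWeilCohomology.algebraicClasses / .HasProdHyperplaneClasses, HodgeRiemannIStatement,
HodgeRiemannIIStatement, baseChangeHom σ (σ : AlgebraicClosure ℚ →+* ℂ),
PeriodRealization.MotivatedPeriodTorsor / .Coord / .IsMotivatedAutFamily (crux 6, support
TorsorGPCImpliesPolicing), HodgeStructure.hodgeClasses / .mumfordTateGroup / .tensorSpace,
tensorSpaceAct, Literature.AlgebraicGeometry.HodgeTheory.HodgeConjectureFor and the summit constant
HodgeConjecture.

CONDITIONAL on Literature.AlgebraicGeometry.Motives.NoriMotivicInterface.GrothendieckPeriodConjecture — this route is an explicit reduction to that named conjecture (D-0019: crux floor waived).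

Rationale: WHY THIS LINE. Transplant from the Kontsevich–Zagier/periods summit (Tannakian transcendence) into
Hodge theory: André's motivated Galois group G_And(X) sits between MT(X) and GL(H_B) and HC(X^•) ⟺
G_And = MT (Andre2004 ch. 7; HuberMullerStachPeriodsIII2015 Prop. 12.2.9). The period conjecture
makes the ℚ̄-closed condition {f : f⁻¹β ∈ Fᵏ H_dR} propagate from the comparison point to the whole
torsor of motivated periods, so G_And(ℚ) permutes Hodge classes of ℚ̄-varieties (card Lemma 1); then
MT ◁ G_And⁰ = MT·C with C reductive, compact-type on Hodge classes (Andre1996Motifs Thm 0.4,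
Deligne1982HodgeCycles Prop. 3.1, Hodge–Riemann), which converts "Hodge ⇒ motivated" for ALL
ℚ̄-varieties into the abelian-flavoured residual C̄ = 1 (a generalised Weil-torus problem, the shape
handled by Andre1996Motifs Thm 0.6.2, Markman2025SecantWeil, arXiv:2603.20268) and prunes every
non-normal intermediate group (G₂ ⊂ SO(7), SO(T) ⊂ SL(T)). What the propagation actually uses is
only the FILTERED, twist-invariant part of GPC_And — crux 6 (C′): filtered points of Ω^And_{X₀} are
ℚ̄-dense, i.e. the period POINT (Hodge flag) is ℚ̄-generic in the motivated flag variety, not the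
full period matrix — strictly weaker than Bost–Charles Conj. 2.12 / HMS Conj. 13.2.5 (genus 1: C′ is
Schneider1937, GPC is open), so since route-choice 2026-08-16 the line carries its period-conjecture
input as that crux and is conditional on nothing outside its items. Sources: Andre2004 ch. 7, 23;
Andre1996Motifs; BostCharles2014 = arXiv:1307.1045; Deligne1982HodgeCycles; Voisin2007HodgeLoci;
KlinglerOtwinowskaUrbanik2023; arXiv:2303.05030 (GPC for Kummer surfaces);
HuberMullerStachPeriods2017 §13.2. Imported area: transcendence/period torsors (crux 6, support
TorsorGPCImpliesPolicing), algebraic groups (normality, compact commutant).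
RANKED CRUXES. (2) PeriodsPoliceHodgeClasses — the policing statement in ℚ-points form over the
tree's Betti/period layer; most informative: an X/ℚ̄ where G_And(ℚ) moves a Hodge class refutes it,
and with it C′ and GPC_And (why it might fail: known only functionally — monodromy ideal,
Andre1996Motifs Thm 0.6.4 — and for abelian motives; sources Andre1996Motifs, BostCharles2014,
Deligne1982HodgeCycles). (3) CompactCommutantTrivial — stability ⇒ Hodge ⊆ motivated for
ℚ̄-definable varieties (C̄ = 1 and π₀ acting trivially); hardest genuinely-Hodge-theoretic step (why
it might fail: C may act non-trivially on CM/Weil-type pieces of non-abelian motives; π₀ invisible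
to ℚ-points; sources Andre1996Motifs, Moonen2017FamiliesMotives, Markman2025SecantWeil). (4)
QbarDescent — HC for ℚ̄-definable varieties ⇒ HC, on the real carriers; weak-absoluteness strength
(Voisin2007HodgeLoci Prop. 1.2, Thm 1.5), the only step leaving ℚ̄ (why it might fail: needs
Hodge-locus components through ℚ̄-generic points defined over ℚ̄ — open beyond abelian varieties and
the KlinglerOtwinowskaUrbanik2023 level ≥ 3 cases). (5) LefschetzB — consumed form: motivated ⇒
algebraic on ℚ̄-definable smooth projective varieties, André's equivalent of B(𝒱_ℚ̄) (why it might
fail: open since 1968 beyond the classical list; sources Andre1996Motifs §2.1 + Prop. 2.2,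
Kleiman1968, arXiv:1009.0413). (6) GrothendieckPeriodConjecture — C′, the filtered torsor form (item
stmt-HodgeConjecture-14635, the refuter's twist-invariant repair of the refuted-misstated ∀P torsor
form stmt-14226): not a hypothesis of `closes`, it is the in-route reason to believe crux 2 (why it
might fail: open beyond genus 1 — false iff a ℚ̄-algebraic relation on the period point of some X₀
is not induced by motivated cycles, cf. the non-motivated de Rham–Betti classes of BostCharles2014
Prop. 2.14; sources BostCharles2014, Andre2004 §7.5/§23.1, HuberMullerStachPeriods2017 Conj. 13.2.5,
Schneider1937). (9, crux) ClassicalBridge — existence of the schema-pinned classical period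
realization whose B-relative HC is the real-carrier HC: construction debt with genuine
inhabitation/normalisation risk as stated (HR-II sign conventions, the (2πi)ⁿ twist of iso_trace),
hence crux-kinded though unranked for staffing. Support: PermutingHodgeTensorsNormalisesMT (provable
now, ~8 lines: an automorphism permuting Hodge tensors normalises MT, card Lemma 1b;
Deligne1982HodgeCycles Prop. 3.1/3.4); TorsorGPCImpliesPolicing (stmt-HodgeConjecture-14611, typed
over the filtered hypothesis = the conclusion of crux 6 at (P, σ, X₀), provable on paper by three
refuter audits: C′ ⇒ every motivated automorphism family of the Betti cohomology of the powers of X₀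
preserves Hodge classes — crux 2 at X₀ up to transport along Y ≅ (X₀)_σ); WeilTypeMultiplets
(informal prediction dim Hdg/Mot ≠ 1, waiting for an algebraic-group rendering of G_And). Deciding
theorem (proved, rev 6; the Assembly item is the same chain as a Prop): classical P from
ClassicalBridge; Hdg ≤ A_mot (crux 3 fed by crux 2 at Y = (X₀)_σ) ≤ A (crux 5) = B-relative HC
(BettiHodgeData.hodgeConjectureFor_iff); ClassicalBridge turns it into
HodgeTheory.HodgeConjectureFor for every ℚ̄-definable X; crux 4 concludes. Every hypothesis of
`closes` is a crux item.
KILL CRITERIA. (i) an X₀/ℚ̄ with G_And(ℚ) (or a computable G_And ⊋ MT not of the form MT·compact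
commutant) moving a Hodge class refutes crux 2 — and, through the provable support
TorsorGPCImpliesPolicing, crux 6 and GPC_And: the route closes refuted, with a publishable
counterexample to the period conjecture; (ii) a provably non-motivated Hodge class on a ℚ̄-variety
stable under G_And (a "lonely" class, dim Hdg/Mot = 1, e.g. a determinant-type class) refutes crux 3
and with it the line; (iii) a non-weakly-absolute Hodge class refutes crux 4 (shared with all
ℚ̄-anchored routes); (iv) a refutation of crux 6 alone (a ℚ̄-relation on a period point not
explained by motivated cycles) kills the upper layer but not the deciding chain — crux 2 would then
need another reason, and the route pivots to attacking crux 2 through monodromy/normality directly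
or retires; refutations through exotic schema-satisfying PeriodRealization data are signature
repairs (swap the schemas for PeriodRealization.IsClassical), not kills — the Deligne-torus twist
that refuted stmt-14226 was exactly such a repair (→ C′).
NOT DECOMPOSED YET. The algebraic-group layer (G_And as a ℚ-group, π₀, reductivity, C compact) —
cruxes are in ℚ-points form with André Thm 0.4/Chevalley bundled into crux 3; "B only for the
auxiliary family 𝒱_X" instead of B(𝒱_ℚ̄); transport along Hodge loci (André Thm 0.5) inside crux 4;
the multiplet/pruning corollaries; the transport glue crux 6 + TorsorGPCImpliesPolicing ⇒ crux 2
(powers of X₀ vs an arbitrary product-closed family). Deliberately NOT filed: GPC proper (Z_X =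
Ω^And / ev_M injective for the classical Nori instance) and the two definitions it would need to be
a non-vacuous Prop — a de Rham/comparison clause (iii) for PeriodRealization.IsClassical and a
classical-instance constant or IsNoriRealization predicate for NoriMotivicInterface (the Nori–André
comparison, Arapura doi:10.1016/j.aim.2012.10.004, behind it) — because nothing in the deciding
chain consumes more than C′. Schema-pinning (HR I/II + hard Lefschetz + product polarisations) is a
stand-in for PeriodRealization.IsClassical; the summit's refuted-statement index was empty at open;
since then the ∀P torsor form stmt-HodgeConjecture-14226 of crux 6 was refuted-misstated on paper
(Deligne-torus twist, refuter evidence EVIDENCE-stmt-HodgeConjecture-14226.md) and replaced by C′ —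
never to be re-filed.
CHEAPEST FALSIFIER. For the deciding chain: kill (i) — take a ℚ̄-variety whose Mumford–Tate group is
known NOT to be normal in a natural motivated overgroup candidate (weight-2 Hodge structures of K3
type with MT of type G₂ ⊂ SO(7) or SO(T) ⊂ SL(T); CM abelian varieties are safe by Andre1996Motifs
Thm 0.6.2) and test whether some motivated automorphism moves a Hodge class — one explicit example
refutes crux 2, C′ and GPC_And at once. For the upper layer: the genus-1 case of C′ is a theorem
(Schneider1937 non-CM; CM trivial) and was the refuter's probe that exposed the misstated ∀P form;
the first open instance is an abelian surface over ℚ̄ (ℚ̄-genericity of τ in the 3-dimensional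
Lagrangian flag variety).

Novelty: Nearest prior (ideator's searches + novelty audit
refuter-novelty-audit-HodgeConjecture-HodgeConjecture-4-0, grade new-combination; planner re-ran lit
frontier/bridges and read Voisin2007HodgeLoci pp. 2–3, HuberMullerStachPeriodsIII2015 pp. 36–37):
Andre2004 ch. 7 (MT ⊆ G_mot, HC(X^•) ⟺ equality), ch. 23 Rem. 23.1.4.2 (period torsor; GPC + HC ⇒
trdeg = dim MT, = HuberMullerStachPeriodsIII2015 Prop. 12.2.9/Cor. 12.2.13); Bost–Charles
arXiv:1307.1045 Prop. 2.13–2.14, §5 (torsor GPC vs de Rham–Betti and absolute Hodge classes —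
rational structures only); arXiv:2206.08618 (de Rham–Betti groups); André 1992 (monodromy ◁ generic
MT, functional analogue); Deligne1982HodgeCycles Prop. 3.1/3.4; Arapura
doi:10.1016/j.aim.2012.10.004 (André = pure Nori motives, for the conditional input). DELTA: the
ℚ̄-closed Hodge-FILTRATION condition {f : f⁻¹β ∈ F^k H_dR} on the motivated period torsor: GPC_And ⇒
Hodge classes G_And-stable ⇒ MT ◁ G_And⁰ = MT·C, C of compact type, with multiplet (dim Hdg/Mot ≠ 1)
and pruning (no G₂ ⊂ SO(7)-type enlargement) corollaries, reducing Hodge ⇒ motivated under GPC to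
the generalised Weil-torus problem C̄ = 1; rendered here in ℚ-points over the tree's Betti/period
layer (PeriodRealization, motivatedClasses, mumfordTateGroup) with a provable normality lemma and an
8-line assembly glue. Not found in print; possibly folklore (André/Ayoub circle), flagged.  [refs: 10.1016/j.aim.2012.10.004, 1307.1045, 2206.08618, doi:10.1016/j.aim.2012.10.004, HuberMullerStachPeriodsIII2015, Andre2004]

Barriers (technique_class: period-torsor-transcendence, motivic-galois-normality): technique_class: period-torsor-transcendence, motivic-galois-normality
- Literature.Barriers.HodgeConjecture.Serre1964_conjugateVarieties_notHomeomorphic,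
Literature.Barriers.HodgeConjecture.Charles2009_conjugateVarieties_cohomologyAlgebrasNotIso:
respected — no Betti class is moved under Aut(ℂ); only the COMPARISON POINT moves inside the
ℚ̄-torsor of motivated comparison isomorphisms (PeriodRealization.iso/iso_fil; Bost–Charles §2);
cruxes quantify over automorphisms of H_B fixing motivated classes, never field automorphisms.
- Literature.Barriers.HodgeConjecture.hodgeClassesAreAbsoluteFor_abelianVariety,
Literature.Barriers.HodgeConjecture.Andre1996_hodgeClassesOnAbelianVarieties_motivated: consistent —
on abelian varieties C ⊆ MT is André Thm 0.6.2; the bridge aims at non-abelian type; QbarDescent is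
of weak-absoluteness strength (Deligne 2.11: abelian varieties only) and says so.
- Literature.Barriers.HodgeConjecture.Weil1977_exceptionalHodgeClasses,
Literature.Barriers.HodgeConjecture.Mumford1968_simpleFourfold_exceptionalHodgeClasses: met head-on
— under GPC the only excess of Hodge over motivated is a compact Weil-type group in the commutant of
MT in G_And; CompactCommutantTrivial is that residual (model kills: Markman2025SecantWeil,
arXiv:2603.20268); nothing divisor-generated is assumed.
- Literature.Barriers.HodgeConjecture.CattaniDeligneKaplan1995_hodgeLocus_algebraicFor: used
positively — QbarDescent needs fields of definition of the algebraic Hodge loci (Voisin20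

History (route lifecycle, newest last):
- 2026-08-15T16:17:29Z · rev 6: restated LefschetzB (stmt-HodgeConjecture-1201) — route-repair g2 (rbadge-HodgeConjecture-PeriodsPolice-6b2e5ea1-g2, planner one-shot 2026-08-15): (1) GLUE — deciding theorem `closes : PeriodsPoliceHodgeClasses (planner-rbadge-HodgeConjecture-PeriodsPolice-6b2e5ea1-g2-0)
- 2026-08-16T02:17:27Z · AUTO-CRUX: 1 conjecture-grade item(s) promoted to crux (TorsorGPCImpliesPolicing) — refuter vetting / tiering apply (operator:999:1362873)
- 2026-08-16T03:57:38Z · rev 8: restated GrothendieckPeriodConjecture (stmt-HodgeConjecture-14226) — repair: GrothendieckPeriodConjecture (stmt-HodgeConjecture-14226) refuted-misstated on paper by refuter-rattack-stmt-HodgeConjecture-14226-0 (Deligne-torus twis (planner-rrefute-HodgeConjecture-PeriodsPolice--928238c5-0)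
- 2026-08-16T04:11:18Z · rev 11: restated GrothendieckPeriodConjecture (stmt-HodgeConjecture-14585) — route-choice gen 2, edit 2 (RESTORE after race): at 03:57:38Z planner-rrefute-…-928238c5-0 (route-item-refuted repair lane) restated crux GrothendieckPeriodConj (planner-rchoice-HodgeConjecture-PeriodsPolice--1266c828-g2-0)
- 2026-08-16T05:00:59Z · rev 15: restated GrothendieckPeriodConjecture (stmt-HodgeConjecture-14635), PeriodsPoliceHodgeClasses (stmt-HodgeConjecture-1198), CompactCommutantTrivial (stmt-HodgeConjecture-1199), ClassicalBridge (stmt-HodgeConjecture-1202) — repair (route-repair rrefute-…-0c9c591b): GrothendieckPeriodConjecture (stmt-14635) refute (planner-rrefute-HodgeConjecture-PeriodsPolice--0c9c591b-0)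
- 2026-08-27T04:03:41Z · DORMANT — reconciler: no traction for 5 d (last activity item-proof-filed at 2026-08-22T02:29:18Z); parked, not closed — `ledger route dormant route-HodgeConjecture-Perio (operator:999:1240124)

sub-problem: HodgeConjecture · status: dormant · opened planner-plancard-HodgeConjecture-HodgeConject-302d00b2-0 2026-08-15T10:53:41Z · rev 17 · ledger route-HodgeConjecture-PeriodsPolice
GENERATED by the gate from the ledger (D-0016/17). Provers cite these decls: `theorem foo : Summit.HodgeConjecture.HodgeConjecture.Theses.PeriodsPolice.<Decl> := …` in Summits/HodgeConjecture/HodgeConjecture/Theorems/<Name>.lean.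
-/

namespace Summit.HodgeConjecture.HodgeConjecture.Theses.PeriodsPolice

open scoped BigOperators Topology Manifold Classical MeasureTheory ProbabilityTheory Matrix InnerProductSpace ComplexConjugate ContinuousMap
open Filter Set Function TopologicalSpace MeasureTheory

attribute [summit_statement] _root_.HodgeConjecture
attribute [route_premise "route-HodgeConjecture-PeriodsPolice"] _root_.Literature.AlgebraicGeometry.Motives.NoriMotivicInterface.GrothendieckPeriodConjecture

-- earlier PeriodsPoliceHodgeClasses (stmt-HodgeConjecture-1198, replaced 2026-08-16T05:00:59Z -> stmt-HodgeConjecture-14650): retired by None — open Literature.AlgebraicGeometry.Motives CategoryTheory.MonoidalCategory in ∀ (P : PeriodRealization (AlgebraicClosure ℚ)), HodgeRiemannIStatement P.B → HodgeRiemannIIStatement P.B → P.B.W.HasHardLefschetz → P.B.W.HasProdHyperplaneClasses → ∀ (σ : Algebraic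
/-- item stmt-HodgeConjecture-14650 · crux · rank 2 · open · by planner
why it might fail: G_And(Y)(ℚ) normalises MT(Y) for all ℚ̄-varieties Y: implied by HC; known only functionally (André 1996 Thm 0.6.4) and for abelian motives; false iff some ℚ̄-Y has MT non-normal in G_And (G₂⊂SO(7), SO(T)⊂SL(T) enlargements) — that would refute torsor-GPC_And itself.
sources: Andre1996Motifs, BostCharles2014, arXiv:1307.1045, Andre2004, Deligne1982HodgeCycles, Moonen2017FamiliesMotives
[crux] REPAIRED 2026-08-16 (route-repair rrefute-…-0c9c591b; refuted-misstated on paper, COLLATERAL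
of the crux-attack on stmt-14635 by refuter-rattack-stmt-HodgeConjecture-14585-0, memo §3 attached
to stmt-1198: for the real Hodge-group transport P^γ = (dR, γ·B.hodge, γ∘iso) — all
PeriodRealization fields and the four schemas hold on paper, and hodge^γ on the powers of E_σ (E/ℚ̄
non-CM) is the Hodge structure of the powers of E_i = ℂ/ℤ[i] — take S = ⊗-closure of {E_σ}, g =
∧•(diag(2,½)^{⊕m}) on members: natural (End E = ℤ), multiplicative, fixing motivated classes, yet it
sends the hodge^γ-Hodge class e₁e₁+e₂e₂ of Y = E_σ ⊗ E_σ (p = 1) to 4e₁e₁+¼e₂e₂ ∉ Hdg). NEW: the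
Hodge-structure pin `P.B.IsClassicalHodge →` (Literature BettiHodgeClassicalPin: B.hodge IS the
Hodge structure of Y^an, VoisinHodgeI2002 §7.1.1) inserted after `∀ P` — the witness misses it; the
rest verbatim. PERIODS POLICE HODGE CLASSES (card Lemma 1, the OUTPUT of the conditional input
GPC_And): for the pinned, schema-satisfying (HR-I/II, hard Lefschetz, product polarisations) period
realization P over ℚ̄, every σ : ℚ̄ →+* ℂ and every product-closed family S of complex varieties:
every family g = (g_Y ∈ GL(Hⁱ_B(Y, -/
@[route_item "route-HodgeConjecture-PeriodsPolice", crux]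
def PeriodsPoliceHodgeClasses : Prop :=
  open Literature.AlgebraicGeometry.Motives CategoryTheory.MonoidalCategory in ∀ (P : PeriodRealization (AlgebraicClosure ℚ)), P.B.IsClassicalHodge → HodgeRiemannIStatement P.B → HodgeRiemannIIStatement P.B → P.B.W.HasHardLefschetz → P.B.W.HasProdHyperplaneClasses → ∀ (σ : AlgebraicClosure ℚ →+* ℂ), ∀ (S : Set (SchemeOver ℂ)), (∀ Y ∈ S, ∀ Y' ∈ S, Y ⊗ Y' ∈ S) → ∀ (g : ∀ (Y : SchemeOver ℂ) (i : ℕ), P.B.W.obj Y i ≃ₗ[ℚ] P.B.W.obj Y i), (∀ ⦃m : ℕ⦄ ⦃Y : SchemeOver ℂ⦄, Y ∈ S → IsSmoothProjective m Y → ∀ ⦃m' : ℕ⦄ ⦃Y' : SchemeOver ℂ⦄, Y' ∈ S → IsSmoothProjective m' Y' → ∀ (f : Y ⟶ Y') (i : ℕ) (x : P.B.W.obj Y' i), g Y i (P.B.W.pullback f i x) = P.B.W.pullback f i (g Y' i x)) → (∀ ⦃m : ℕ⦄ ⦃Y : SchemeOver ℂ⦄, Y ∈ S → IsSmoothProjective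 m Y → ∀ ⦃i j l : ℕ⦄ (h : i + j = l) (x : P.B.W.obj Y i) (y : P.B.W.obj Y j), g Y l (P.B.W.cup h x y) = P.B.W.cup h (g Y i x) (g Y j y)) → (∀ ⦃m : ℕ⦄ ⦃Y : SchemeOver ℂ⦄, Y ∈ S → IsSmoothProjective m Y → ∀ (p : ℕ), ∀ x ∈ P.B.W.motivatedClasses m Y p, g Y (2 * p) x = x) → ∀ ⦃n : ℕ⦄ ⦃Y : SchemeOver ℂ⦄, Y ∈ S → (∃ X₀ : SchemeOver (AlgebraicClosure ℚ), Nonempty (Y ≅ (baseChangeHom σ).obj X₀)) → ∀ (hY : IsSmoothProjective n Y) (p : ℕ), ∀ x ∈ (P.B.hodge hY (2 * p)).hodgeClasses p, g Y (2 * p) x ∈ (P.B.hodge hY (2 * p)).hodgeClasses p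

-- earlier CompactCommutantTrivial (stmt-HodgeConjecture-1199, replaced 2026-08-16T05:00:59Z -> stmt-HodgeConjecture-14651): retired by None — open Literature.AlgebraicGeometry.Motives CategoryTheory.MonoidalCategory in ∀ (P : PeriodRealization (AlgebraicClosure ℚ)), HodgeRiemannIStatement P.B → HodgeRiemannIIStatement P.B → P.B.W.HasHardLefschetz → P.B.W.HasProdHyperplaneClasses → ∀ (σ : AlgebraicCl
/-- item stmt-HodgeConjecture-14651 · crux · rank 3 · open · by planner
why it might fail: = Hodge ⇒ motivated on ℚ̄-varieties from ℚ-point stability, which only gives G_And⁰ = MT·C with C = Cent(MT)⁰ compact-type on Hdg: C may act non-trivially on CM/Weil-type pieces of non-abelian motives (surfaces p_g ≥ 2, CY3); π₀(G_And) is invisible to stability; known for abelian motives only.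
sources: Andre1996Motifs, Moonen2017FamiliesMotives, Deligne1982HodgeCycles, vanGeemen1994HodgeAV, Markman2025SecantWeil, VoisinHodgeI2002
[crux] RESTATED 2026-08-16 (route-repair rrefute-…-0c9c591b, the uniform Hodge pin recommended by
refuter-rattack-stmt-HodgeConjecture-14585-0: the item reads B.hodge, which the ∀P schema prefix
does not pin; it is not itself falsified by the P^γ witness — its hypothesis fails there — but it is
exposed to the same exotic family, and `closes` must feed it the pinned crux 2). NEW:
`P.B.IsClassicalHodge →` inserted after `∀ P`; the rest verbatim. COMPACT COMMUTANT IS TRIVIAL — the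
card's residual C̄ = 1, in ℚ-points form with André's Thm 0.4 / Chevalley bundled in. For the
pinned, schema-satisfying P and σ: IF for every product-closed family S the ℚ-points of G¹_And(⟨S⟩)
preserve the Hodge classes of the ℚ̄-definable members of S (exactly the conclusion of
PeriodsPoliceHodgeClasses), THEN the Hodge classes of every ℚ̄-definable smooth projective Y are
motivated: Hdgᵖ(Y) ≤ A_motᵖ(Y) = P.B.W.motivatedClasses. Mechanism (card Lemma 2): stability ⇒ MT ◁
G_And⁰ and G_And⁰ = MT·C, C = Cent(MT)⁰ connected reductive (Andre1996Motifs Thm 0.4: G_And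
reductive, motivated classes = G_And-invariants; Deligne1982HodgeCycles Prop. 3.1), acting on each
Hdgᵖ through a group with COMPACT real points (C -/
@[route_item "route-HodgeConjecture-PeriodsPolice", crux]
def CompactCommutantTrivial : Prop :=
  open Literature.AlgebraicGeometry.Motives CategoryTheory.MonoidalCategory in ∀ (P : PeriodRealization (AlgebraicClosure ℚ)), P.B.IsClassicalHodge → HodgeRiemannIStatement P.B → HodgeRiemannIIStatement P.B → P.B.W.HasHardLefschetz → P.B.W.HasProdHyperplaneClasses → ∀ (σ : AlgebraicClosure ℚ →+* ℂ), (∀ (S : Set (SchemeOver ℂ)), (∀ Y ∈ S, ∀ Y' ∈ S, Y ⊗ Y' ∈ S) → ∀ (g : ∀ (Y : SchemeOver ℂ) (i : ℕ), P.B.W.obj Y i ≃ₗ[ℚ] P.B.W.obj Y i), (∀ ⦃m : ℕ⦄ ⦃Y : SchemeOver ℂ⦄, Y ∈ S → IsSmoothProjective m Y → ∀ ⦃m' : ℕ⦄ ⦃Y' : SchemeOver ℂ⦄, Y' ∈ S → IsSmoothProjective m' Y' → ∀ (f : Y ⟶ Y') (i : ℕ) (x : P.B.W.obj Y' i), g Y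 i (P.B.W.pullback f i x) = P.B.W.pullback f i (g Y' i x)) → (∀ ⦃m : ℕ⦄ ⦃Y : SchemeOver ℂ⦄, Y ∈ S → IsSmoothProjective m Y → ∀ ⦃i j l : ℕ⦄ (h : i + j = l) (x : P.B.W.obj Y i) (y : P.B.W.obj Y j), g Y l (P.B.W.cup h x y) = P.B.W.cup h (g Y i x) (g Y j y)) → (∀ ⦃m : ℕ⦄ ⦃Y : SchemeOver ℂ⦄, Y ∈ S → IsSmoothProjective m Y → ∀ (p : ℕ), ∀ x ∈ P.B.W.motivatedClasses m Y p, g Y (2 * p) x = x) → ∀ ⦃n : ℕ⦄ ⦃Y : SchemeOver ℂ⦄, Y ∈ S → (∃ X₀ : SchemeOver (AlgebraicClosure ℚ), Nonempty (Y ≅ (baseChangeHom σ).obj X₀)) → ∀ (hY : IsSmoothProjective n Y) (p : ℕ), ∀ x ∈ (P.B.hodge hY (2 * p)).hodgeClasses p, g Y (2 * p) x ∈ (P.B.hodge hY (2 * p)).hodgeClasses p) → ∀ ⦃n : ℕ⦄ ⦃Y : SchemeOver ℂ⦄, (∃ X₀ : SchemeOver (AlgebraicClosure ℚ), Nonempty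 (Y ≅ (baseChangeHom σ).obj X₀)) → ∀ (hY : IsSmoothProjective n Y) (p : ℕ), (P.B.hodge hY (2 * p)).hodgeClasses p ≤ P.B.W.motivatedClasses n Y p

/-- item stmt-HodgeConjecture-1200 · crux · rank 4 · open · by planner
why it might fail: A -> HC, A = HC over Qbar: false iff HC fails only at transcendental X. Only known route (Voisin 2007 Prop 1.2, Thm 1.5, Prop 1.7) needs all Hodge classes weakly absolute (locus components at Qbar-generic points defined over Qbar): open beyond AV, KOU level>=3, motivic loci; isolated points escape.
sources: Voisin2007HodgeLoci, KlinglerOtwinowskaUrbanik2023, arXiv:2603.22171, CattaniDeligneKaplan1995, Deligne1982HodgeCycles, CharlesSchnell2014Notes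
[crux] ℚ̄-DESCENT on the real carriers: the Hodge conjecture (HodgeTheory.HodgeConjectureFor,
singular cohomology of complex points) for every smooth projective complex variety of the form X₀
×_{ℚ̄,σ} ℂ implies the Hodge conjecture. Voisin2007HodgeLoci Prop. 1.2: HC for ℚ̄-varieties ⇒ HC for
(weakly) absolute Hodge classes; Thm 1.5 / Prop. 1.7: if a Hodge-locus component carries no constant
sub-VHS but ℚα it is defined over ℚ̄ and the class is covered. The general case is 'Hodge-locus
components through ℚ̄-generic points are defined over ℚ̄' (weak absoluteness) — OPEN;
KlinglerOtwinowskaUrbanik2023 give ℚ̄-definability for positive-period-dimension special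
subvarieties of level ≥ 3, not for all components; the return from a ℚ̄-point of the locus to the
generic point is André's deformation theorem (Andre1996Motifs Thm 0.5, motivated-ness is horizontal)
under B. Shared mechanism with cards motivated-anchor-transport / qbar-anchors-kou-andre-motivated
(other routes may want the same decl). In this route it is the only step leaving ℚ̄, where GPC says
nothing. Sources: Voisin2007HodgeLoci Prop. 1.2, Thm 1.5, Prop. 1.7; KlinglerOtwinowskaUrbanik2023;
CharlesSchnell2014Notes §11.2.5, Thm -/
@[route_item "route-HodgeConjecture-PeriodsPolice", crux]
def QbarDescent : Prop :=
  open Literature.AlgebraicGeometry.Motives Literature.AlgebraicGeometry.HodgeTheory in (∀ (σ : AlgebraicClosure ℚ →+* ℂ) ⦃n : ℕ⦄ ⦃X₀ : SchemeOver (AlgebraicClosure ℚ)⦄, IsSmoothProjective n ((baseChangeHom σ).obj X₀) → HodgeConjectureFor n ((baseChangeHom σ).obj X₀)) → _root_.HodgeConjecture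

-- earlier LefschetzB (stmt-HodgeConjecture-1201, replaced 2026-08-15T16:17:29Z -> stmt-HodgeConjecture-10505): retired by None — open Literature.AlgebraicGeometry.Motives CategoryTheory.MonoidalCategory in ∀ (P : PeriodRealization (AlgebraicClosure ℚ)), HodgeRiemannIStatement P.B → HodgeRiemannIIStatement P.B → P.B.W.HasHardLefschetz → P.B.W.HasProdHyperplaneClasses → P.B.W.LefschetzStandardConjectu
/-- item stmt-HodgeConjecture-10505 · crux · rank 5 · open · by planner
why it might fail: Strength of B for Qbar-definable varieties (A_mot = A on V_Qbar <=> B(V_Qbar): Andre 1996 §2.1 remark + Prop. 2.2): open since 1968 beyond curves, surfaces, AV (Lieberman), complete intersections, flag varieties, K3^[n]-type and Lagrangian-covered HK (1009.0413, 2007.11872); no proof short of B.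
sources: Andre1996Motifs, Grothendieck1969StandardConjectures, Kleiman1968, Kleiman1994StandardConjectures, Lieberman1968, arXiv:1009.0413
[crux] LEFSCHETZ-B INPUT IN THE CONSUMED FORM (André's equivalent formulation, restricted to
ℚ̄-definable varieties; route-repair g2 restate of the earlier 'B for every schema-pinned Betti
theory and every complex X'): for the classical period realization P over ℚ̄ (schema-pinned by
Hodge–Riemann I/II + hard Lefschetz + product polarisations), every σ : ℚ̄ →+* ℂ and every smooth
projective X = X₀ ×_{ℚ̄,σ} ℂ, motivated classes are algebraic: A_motᵖ(X) ≤ ℚ·Aᵖ(X) (tree: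
WeilCohomology.motivatedClasses ≤ WeilCohomology.algebraicClasses), all p. This is exactly what the
assembly consumes (Hdg ≤ A_mot by CompactCommutantTrivial, then A_mot ≤ A here). Relation to
Grothendieck's B: B for the Betti theory ⇒ this, by the tree THEOREM
WeilCohomology.motivatedClasses_le_algebraicClasses (André 1996 §2.1, remark after Déf. 1, p. 14:
'A_mot(X) = A(X) si pour tout Y ∈ 𝒱 polarisé l'involution de Lefschetz est donnée par une
correspondance algébrique'; Kleiman 1968 Prop. 2.3), so the old item implies the new one (checked in
the planner sketch); conversely A_mot = A on a product-closed family 𝒱 ⇒ B(𝒱), since ⋆ and the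
Künneth projectors are motivated correspondences (André 1996 Prop. 2.2, p. 16) — h -/
@[route_item "route-HodgeConjecture-PeriodsPolice", crux]
def LefschetzB : Prop :=
  open Literature.AlgebraicGeometry.Motives CategoryTheory.MonoidalCategory in ∀ (P : PeriodRealization (AlgebraicClosure ℚ)), HodgeRiemannIStatement P.B → HodgeRiemannIIStatement P.B → P.B.W.HasHardLefschetz → P.B.W.HasProdHyperplaneClasses → ∀ (σ : AlgebraicClosure ℚ →+* ℂ) ⦃n : ℕ⦄ ⦃X₀ : SchemeOver (AlgebraicClosure ℚ)⦄, IsSmoothProjective n ((baseChangeHom σ).obj X₀) → ∀ p : ℕ, P.B.W.motivatedClasses n ((baseChangeHom σ).obj X₀) p ≤ P.B.W.algebraicClasses ((baseChangeHom σ).obj X₀) p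

-- earlier ClassicalBridge (stmt-HodgeConjecture-1202, replaced 2026-08-16T05:00:59Z -> stmt-HodgeConjecture-14652): retired by None — open Literature.AlgebraicGeometry.Motives Literature.AlgebraicGeometry.HodgeTheory in ∃ P : PeriodRealization (AlgebraicClosure ℚ), (HodgeRiemannIStatement P.B ∧ HodgeRiemannIIStatement P.B ∧ P.B.W.HasHardLefschetz ∧ P.B.W.HasProdHyperplaneClasses) ∧ ∀ (σ : AlgebraicC
/-- item stmt-HodgeConjecture-14652 · crux · rank 9 · open · by planner
why it might fail: Inhabitation risk, not only XL size: the hypothesis structures may be mis-normalised so the classical data fail them verbatim — HR-II sign/primitivity conventions vs Voisin 6.32, the (2πi)^n twist of iso_trace, Weil-axiom normalisations over bettiFunctor, the comap form of the pin.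
sources: VoisinHodgeI2002, Grothendieck1966, Deligne1982HodgeCycles, Deligne2000, Kleiman1968
[support] RESTATED 2026-08-16 (route-repair rrefute-…-0c9c591b): the classical realization is now
delivered WITH the Hodge-structure pin — `∃ P, P.B.IsClassicalHodge ∧ (HR-I ∧ HR-II ∧ hard Lefschetz
∧ product polarisations) ∧ bridge` — so that the deciding theorem `closes` can feed the pinned
cruxes PeriodsPoliceHodgeClasses / CompactCommutantTrivial
(refuter-rattack-stmt-HodgeConjecture-14585-0: 'deliver a pinned P in ClassicalBridge').
CONSTRUCTION / infrastructure debt shared by every route using the abstract Betti–de Rham layer (the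
tree constructs no classical datum): there is a period realization P over ℚ̄ — Betti cohomology of
complex points with its GENUINE Hodge structures (the pin BettiHodgeData.IsClassicalHodge of
Literature BettiHodgeClassicalPin: Hodge pieces and Hodge filtration of B.hodge are the preimages of
those of X^an under the model comparison, VoisinHodgeI2002 §6.1.3 Prop. 6.11, §7.1.1 Def. 7.4/Prop.
7.5), trace and cycle classes, algebraic de Rham cohomology with its Hodge filtration,
Grothendieck's comparison (Grothendieck1966 Thm 1'; Deligne1982HodgeCycles §1) — satisfying the
classicality schemas (HodgeRiemannIStatement, HodgeRiemannIIStatement: VoisinHodg -/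
@[route_item "route-HodgeConjecture-PeriodsPolice", crux]
def ClassicalBridge : Prop :=
  open Literature.AlgebraicGeometry.Motives Literature.AlgebraicGeometry.HodgeTheory in ∃ P : PeriodRealization (AlgebraicClosure ℚ), P.B.IsClassicalHodge ∧ (HodgeRiemannIStatement P.B ∧ HodgeRiemannIIStatement P.B ∧ P.B.W.HasHardLefschetz ∧ P.B.W.HasProdHyperplaneClasses) ∧ ∀ (σ : AlgebraicClosure ℚ →+* ℂ) ⦃n : ℕ⦄ ⦃X₀ : SchemeOver (AlgebraicClosure ℚ)⦄ (hX : IsSmoothProjective n ((baseChangeHom σ).obj X₀)), (∀ p : ℕ, P.B.HodgeConjectureFor hX p) → HodgeConjectureFor n ((baseChangeHom σ).obj X₀)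

-- earlier GrothendieckPeriodConjecture (stmt-HodgeConjecture-14226, replaced 2026-08-16T03:57:38Z -> stmt-HodgeConjecture-14573): retired by None — open Literature.AlgebraicGeometry.Motives in ∀ (P : PeriodRealization (AlgebraicClosure ℚ)), HodgeRiemannIStatement P.B → HodgeRiemannIIStatement P.B → P.B.W.HasHardLefschetz → P.B.W.HasProdHyperplaneClasses → ∀ (σ : AlgebraicClosure ℚ →+* ℂ) ⦃n : ℕ⦄ ⦃X₀
-- earlier GrothendieckPeriodConjecture (stmt-HodgeConjecture-14573, replaced 2026-08-16T03:58:33Z -> stmt-HodgeConjecture-14585): retired by None — open Literature.AlgebraicGeometry.Motives in ∀ (P : PeriodRealization (AlgebraicClosure ℚ)), HodgeRiemannIStatement P.B → HodgeRiemannIIStatement P.B → P.B.W.HasHardLefschetz → P.B.W.HasProdHyperplaneClasses → ∀ (σ : AlgebraicClosure ℚ →+* ℂ) ⦃n : ℕ⦄ ⦃X₀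
-- earlier GrothendieckPeriodConjecture (stmt-HodgeConjecture-14585, replaced 2026-08-16T04:11:18Z -> stmt-HodgeConjecture-14635): retired by None — open Literature.AlgebraicGeometry.Motives in ∃ P : PeriodRealization (AlgebraicClosure ℚ), P.B.IsClassicalHodge ∧ (HodgeRiemannIStatement P.B ∧ HodgeRiemannIIStatement P.B ∧ P.B.W.HasHardLefschetz ∧ P.B.W.HasProdHyperplaneClasses) ∧ ∀ (σ : AlgebraicClosu
-- earlier GrothendieckPeriodConjecture (stmt-HodgeConjecture-14635, replaced 2026-08-16T05:00:59Z -> stmt-HodgeConjecture-14649): retired by None — open Literature.AlgebraicGeometry.Motives in ∀ (P : PeriodRealization (AlgebraicClosure ℚ)), HodgeRiemannIStatement P.B → HodgeRiemannIIStatement P.B → P.B.W.HasHardLefschetz → P.B.W.HasProdHyperplaneClasses → ∀ (σ : AlgebraicClosure ℚ →+* ℂ) ⦃n : ℕ⦄ ⦃X₀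
/-- item stmt-HodgeConjecture-14649 · aside · rank 6 · open · by planner
why it might fail: Open beyond genus 1 (non-CM E: Schneider 1937; CM E trivial): needs Z_X·Q = Ω^And, i.e. trdeg(periods of X₀^•) ≥ dim G_And/Stab(F) in general position — open for abelian surfaces; false iff a ℚ̄-period relation of some X₀ kills all of c·Q (non-motivated dR–Betti class, BostCharles2014 Prop 2.14).
sources: BostCharles2014, arXiv:1307.1045, Andre2004, HuberMullerStachPeriods2017, HuberMullerStachPeriodsIII2015, HuberWustholz2022
[crux] REPAIRED 2026-08-16 (route-repair rrefute-…-0c9c591b; refuted-misstated on paper by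
refuter-rattack-stmt-HodgeConjecture-14585-0, EVIDENCE-stmt-HodgeConjecture-14635.md + W.lean on
stmt-14635: the ∀P schema prefix (HR-I/II, HL, ProdHyp) pins P.B.W but NOT P.B.hodge; the real
Hodge-group transport P^γ = (dR, γ·B.hodge, γ∘iso), γ ∈ lim_S Hg_S(ℝ) natural/multiplicative/real
fixing all Hodge (hence motivated) classes, with γ|H¹(E_σ) ∈ SL₂(ℝ) moving the Hodge line of a
non-CM E/ℚ̄ to ℂ(e₁+ie₂), keeps every PeriodRealization field, the four schemas and Ω^And, yet Φ =
X_(1,1,v,e₂*) − i·X_(1,1,v,e₁*) vanishes on every filtered complex point and Φ(act(diag(2,½))(c^γ))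
= −(3i/2)μ ≠ 0). NEW = the refuter's C′ (W.lean GPCProbe.CruxRepaired, rc 0): the Hodge-structure
pin `P.B.IsClassicalHodge →` (Literature BettiHodgeClassicalPin: B.hodge IS the Hodge structure of
X^an, VoisinHodgeI2002 §7.1.1 Def. 7.4/Prop. 7.5) inserted after `∀ P`; the rest verbatim = the
FILTERED (parabolic) form of the Grothendieck–André period conjecture: for pinned, schema-satisfying
P over ℚ̄, σ : ℚ̄ →+* ℂ and X₀/ℚ̄ smooth projective of dimension n, every ℚ̄-polynomial in the
affine coordinates of the torsor of -/
@[route_item "route-HodgeConjecture-PeriodsPolice"]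
def GrothendieckPeriodConjecture : Prop :=
  open Literature.AlgebraicGeometry.Motives in ∀ (P : PeriodRealization (AlgebraicClosure ℚ)), P.B.IsClassicalHodge → HodgeRiemannIStatement P.B → HodgeRiemannIIStatement P.B → P.B.W.HasHardLefschetz → P.B.W.HasProdHyperplaneClasses → ∀ (σ : AlgebraicClosure ℚ →+* ℂ) ⦃n : ℕ⦄ ⦃X₀ : SchemeOver (AlgebraicClosure ℚ)⦄, IsSmoothProjective n X₀ → ∀ Φ : MvPolynomial (P.Coord σ X₀) (AlgebraicClosure ℚ), (∀ f₀ : P.MotivatedPeriodTorsor σ n X₀ (AlongHom ℂ σ), (∀ (m i : ℕ) (hXσ : IsSmoothProjective (m * n) ((baseChangeHom σ).obj (X₀.pow m))) (p : ℤ), ((((P.dR.fil (X := X₀.pow m) i p).baseChange (AlongHom ℂ σ)).map (f₀.iso m i).toLinearMap).restrictScalars ℚ).map (alongHomTensorEquiv σ ((P.B.comap σ).obj (X₀.pow m) i)).toLinearMap = ((P.B.hodge hXσ i).F p).restrictScalars ℚ) → MvPolynomial.aeval f₀.coord Φ = 0) → ∀ (R : Type) [CommRing R] [Algebra (AlgebraicClosure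 ℚ) R] [Algebra ℚ R] (f : P.MotivatedPeriodTorsor σ n X₀ R), MvPolynomial.aeval f.coord Φ = 0

/-- item stmt-HodgeConjecture-1203 · support · rank 9 · closed · proved by Summit.HodgeConjecture.HodgeConjecture.Theorems.periodsPolice_permutingHodgeTensorsNormalisesMT_proof @ 946dcc498332 (prover) · by planner
sources: Deligne1982HodgeCycles, Moonen2004MT
[support, PROVABLE NOW (~8 lines; card Lemma 1b)] In the tree's Mumford–Tate vocabulary
(HodgeTensor: MT(H) = tensorStabilizer of the weight-0 type-(0,0) Hodge tensors,
Deligne1982HodgeCycles Prop. 3.4): an automorphism g of V such that g and g⁻¹ map the Hodge tensors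
of every T^{a,b}V to Hodge tensors conjugates MT(H) into itself. Combined with
PeriodsPoliceHodgeClasses on the powers of X₀ (Künneth + Poincaré duality identify Hodge tensors of
H_B(X) with Hodge classes on powers) this is 'GPC ⇒ MT(X) normalised by G_And(X)(ℚ)'. Proof: for h ∈
MT and t a weight-0 (0,0) Hodge tensor, g⁻¹t is one too, so h(g⁻¹t) = g⁻¹t and (ghg⁻¹)t = t
(HodgeStructure.mem_mumfordTateGroup_iff, tensorSpaceAct_mul_apply, tensorSpaceAct_one) — checked in
the planner's sketch. Sources: Deligne1982HodgeCycles Prop. 3.1, 3.4; Moonen2004MT §4. -/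
@[route_item "route-HodgeConjecture-PeriodsPolice"]
def PermutingHodgeTensorsNormalisesMT : Prop :=
  open Literature.AlgebraicGeometry.Motives in ∀ (V : Type) [AddCommGroup V] [Module ℚ V] [Module.Finite ℚ V] [HodgeTensorFacts.{0, 0}] (n : ℤ) (H : HodgeStructure V n) (g : V ≃ₗ[ℚ] V), (∀ (a b : ℕ) (p : ℤ), ∀ t ∈ (H.tensorSpace a b).hodgeClasses p, tensorSpaceAct g t ∈ (H.tensorSpace a b).hodgeClasses p) → (∀ (a b : ℕ) (p : ℤ), ∀ t ∈ (H.tensorSpace a b).hodgeClasses p, tensorSpaceAct g⁻¹ t ∈ (H.tensorSpace a b).hodgeClasses p) → ∀ h ∈ H.mumfordTateGroup, g * h * g⁻¹ ∈ H.mumfordTateGroup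

-- `PermutingHodgeTensorsNormalisesMT` holds: proved by `Summit.HodgeConjecture.HodgeConjecture.Theorems.periodsPolice_permutingHodgeTensorsNormalisesMT_proof` @ 946dcc498332 (its module imports this route file, so no `_holds` link can be stated here).

-- item stmt-HodgeConjecture-1317 · support · rank 9 · open · by planner — informal only, no Lean statement yet:
--   [support; refutable PREDICTION (card consequences (b) multiplets and (c) pruning); informal until an
--   algebraic-group rendering of G_And exists (definition request motivatedGaloisGroup filed with this
--   route)] For the classical period realization and X = (X₀)_σ ℚ̄-definable: IF the Hodge classes of
--   all powers of X are stable under G_And(X) (conclusion of PeriodsPoliceHodgeClasses), THEN (b) in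
--   every H^{2p}(X^m) the quotient Hdgᵖ/(Hdgᵖ ∩ A_motᵖ) is either 0 or of ℚ-dimension ≥ 2 — a Hodge
--   class that is alone modulo motivated classes is motivated — and (c) every intermediate connected
--   reductive ℚ-

-- earlier TorsorGPCImpliesPolicing (stmt-HodgeConjecture-1312, replaced 2026-08-16T04:03:15Z -> stmt-HodgeConjecture-14611): retired by None — open Literature.AlgebraicGeometry.Motives in ∀ (P : PeriodRealization (AlgebraicClosure ℚ)) (σ : AlgebraicClosure ℚ →+* ℂ) ⦃n : ℕ⦄ ⦃X₀ : SchemeOver (AlgebraicClosure ℚ)⦄, IsSmoothProjective n X₀ → (∀ Φ : MvPolynomial (P.Coord σ X₀) (AlgebraicClosure ℚ), MvPol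
/-- item stmt-HodgeConjecture-14611 · support · rank 9 · closed · proved by Summit.HodgeConjecture.HodgeConjecture.Theorems.periodsPolice_torsorGPCImpliesPolicing_proof @ e5dc8254ccc8 (prover) · by planner
why it might fail: Provable on paper (3 refuter audits of the old form; the filtered hypothesis is exactly what card Lemma 1a uses: S_β ⊇ filtered points); residual risk = Lean plumbing — inverse of an IsMotivatedAutFamily, restrictScalars/alongHomTensorEquiv bookkeeping of the iso_fil shape, mem_hodgeClasses_iff.
sources: BostCharles2014, arXiv:1307.1045, Andre2004, Deligne1982HodgeCycles, HuberMullerStachPeriodsIII2015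
[support-grade bridge lemma (card Lemma 1a), PROVABLE — the open hypothesis is consumed, nothing
open is asserted] RESTATED 2026-08-16 (route-repair, together with the rank-6 crux stmt-14226 →
stmt-14573) over the FILTERED hypothesis: for P : PeriodRealization ℚ̄, σ : ℚ̄ →+* ℂ, X₀/ℚ̄ smooth
projective of dimension n — IF the filtered complex points of the torsor of motivated periods
Ω^And_{X₀} (f₀ ∈ Ω^And_{X₀}(ℂ) carrying Fᵖ Hⁱ_dR(X₀^m) ⊗_{ℚ̄,σ} ℂ onto the Hodge filtration Fᵖ of
Hⁱ_B((X₀^m)_σ) ⊗ ℂ for all m, i, p — the shape of PeriodRealization.iso_fil) are ℚ̄-Zariski dense in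
Ω^And_{X₀} (every ℚ̄-polynomial in the coordinates vanishing at all of them vanishes at every
R-point; = the conclusion of the repaired rank-6 crux (stmt-HodgeConjecture-14573) at (P, σ, X₀),
δ-unfolded identically), THEN every motivated automorphism family g = (g_{m,i}) of the Betti
cohomology of the powers of X₀ (PeriodRealization.IsMotivatedAutFamily: natural, unital,
multiplicative, fixing motivated classes — the ℚ-points of ker(Tate character) ⊂ G_And read on the
powers) maps the Hodge classes Hdgᵖ((X₀^m)_σ) into themselves, for all m, p. The old hypothesis
(tree decl PeriodRealization.TorsorPeriodConje -/
@[route_item "route-HodgeConjecture-PeriodsPolice"]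
def TorsorGPCImpliesPolicing : Prop :=
  open Literature.AlgebraicGeometry.Motives in ∀ (P : PeriodRealization (AlgebraicClosure ℚ)) (σ : AlgebraicClosure ℚ →+* ℂ) ⦃n : ℕ⦄ ⦃X₀ : SchemeOver (AlgebraicClosure ℚ)⦄, IsSmoothProjective n X₀ → (∀ Φ : MvPolynomial (P.Coord σ X₀) (AlgebraicClosure ℚ), (∀ f₀ : P.MotivatedPeriodTorsor σ n X₀ (AlongHom ℂ σ), (∀ (m i : ℕ) (hXσ : IsSmoothProjective (m * n) ((baseChangeHom σ).obj (X₀.pow m))) (p : ℤ), ((((P.dR.fil (X := X₀.pow m) i p).baseChange (AlongHom ℂ σ)).map (f₀.iso m i).toLinearMap).restrictScalars ℚ).map (alongHomTensorEquiv σ ((P.B.comap σ).obj (X₀.pow m) i)).toLinearMap = ((P.B.hodge hXσ i).F p).restrictScalars ℚ) → MvPolynomial.aeval f₀.coord Φ = 0) → ∀ (R : Type) [CommRing R] [Algebra (AlgebraicClosure ℚ) R] [Algebra ℚ R] (f : P.MotivatedPeriodTorsor σ n X₀ R), MvPolynomial.aeval f.coord Φ = 0) → ∀ ⦃g : ∀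 m i : ℕ, (P.B.comap σ).obj (X₀.pow m) i ≃ₗ[ℚ] (P.B.comap σ).obj (X₀.pow m) i⦄, P.IsMotivatedAutFamily σ n X₀ g → ∀ (m : ℕ) (hXm : IsSmoothProjective (m * n) ((baseChangeHom σ).obj (X₀.pow m))) (p : ℕ), ∀ x ∈ (P.B.hodge hXm (2 * p)).hodgeClasses p, g m (2 * p) x ∈ (P.B.hodge hXm (2 * p)).hodgeClasses p

-- `TorsorGPCImpliesPolicing` holds: proved by `Summit.HodgeConjecture.HodgeConjecture.Theorems.periodsPolice_torsorGPCImpliesPolicing_proof` @ e5dc8254ccc8 (its module imports this route file, so no `_holds` link can be stated here).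

/-- item stmt-HodgeConjecture-1204 · assembly · rank 1 · closed · proved by Summit.HodgeConjecture.HodgeConjecture.Theorems.periodsPolice_assembly_proof @ c81700764b6c (prover) · by planner
sources: Andre1996Motifs, Andre2004
[assembly] PeriodsPoliceHodgeClasses → CompactCommutantTrivial → LefschetzB → ClassicalBridge →
QbarDescent → HodgeConjecture. Glue (checked to elaborate AND to be provable in the planner's
sketch, 8 lines): take the classical P from ClassicalBridge; for σ, X₀, p: Hdgᵖ ≤ A_motᵖ
(CompactCommutantTrivial at σ fed with PeriodsPoliceHodgeClasses at σ, Y := (X₀)_σ with the identity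
isomorphism) ≤ Aᵖ (WeilCohomology.motivatedClasses_le_algebraicClasses under LefschetzB, tree
theorem), i.e. P.B.HodgeConjectureFor via BettiHodgeData.hodgeConjectureFor_iff; ClassicalBridge
turns it into HodgeTheory.HodgeConjectureFor for every ℚ̄-definable variety; QbarDescent concludes.
The conditional input GPC_And enters only through PeriodsPoliceHodgeClasses (support
TorsorGPCImpliesPolicing). Sources: Andre1996Motifs; Andre2004. -/
@[route_item "route-HodgeConjecture-PeriodsPolice"]
def Assembly : Prop :=
  PeriodsPoliceHodgeClasses → CompactCommutantTrivial → LefschetzB → ClassicalBridge → QbarDescent → _root_.HodgeConjecture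

-- `Assembly` holds: proved by `Summit.HodgeConjecture.HodgeConjecture.Theorems.periodsPolice_assembly_proof` @ c81700764b6c (its module imports this route file, so no `_holds` link can be stated here).

/-! D-0027 §2.1 — DECIDING THEOREM (planner-authored via `route open/edit --closes-file`; by planner-rrefute-HodgeConjecture-PeriodsPolice--0c9c591b-0 2026-08-16T05:00:59Z):
its hypotheses are this route's items and its conclusion the sub-problem Statement (glue_lint), and it elaborates with this file. -/

@[closes "route-HodgeConjecture-PeriodsPolice"] theorem closes (h₁ : PeriodsPoliceHodgeClasses) (h₂ : CompactCommutantTrivial) (h₃ : QbarDescent)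
    (h₄ : LefschetzB) (h₅ : ClassicalBridge) : _root_.HodgeConjecture := by
  obtain ⟨P, hcl, ⟨hI, hII, hL, hPH⟩, hbr⟩ := h₅
  refine h₃ fun σ n X₀ hX ↦ hbr σ hX fun p ↦ ?_
  rw [_root_.Literature.AlgebraicGeometry.Motives.BettiHodgeData.hodgeConjectureFor_iff]
  exact le_trans
    (h₂ P hcl hI hII hL hPH σ (h₁ P hcl hI hII hL hPH σ) ⟨X₀, ⟨_root_.CategoryTheory.Iso.refl _⟩⟩ hX p)
    (h₄ P hI hII hL hPH σ hX p)

end Summit.HodgeConjecture.HodgeConjecture.Theses.PeriodsPolice
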